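import Mathlib
import HarnessLib
import Summits.Langlands.Statement
import Literature.NumberTheory.Automorphic.AutomorphicRepsGL
import Literature.NumberTheory.Automorphic.HermitianArchParameter
import Literature.NumberTheory.Automorphic.RamakrishnanTensorProductGL2
import Literature.NumberTheory.Automorphic.SelfdualGL3AdjointLift

/-!
# Sketch — crux-ideate stmt-Langlands-14069 (RegularTwistCM), ideator 1, round 1

First lemmas of the three idea cards, stated over existing declarations (elaboration check only).
-/

open scoped BigOperators ComplexConjugate
open Filter NumberField

noncomputable section

namespace Summit.Langlands.Langlands.Cruxes.RegularTwistCM.IdeasK1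

open Literature.NumberTheory.Automorphic Literature.NumberTheory.GaloisRepresentations

/-! ## Card `petersson-hermitian-purity` -/

/-- FIRST LEMMA (card 1). Hermitian symmetry of the archimedean parameter of a CUSPIDAL datum on
`GL_n(𝔸_K)`, up to the real shift coming from the `A_G`-normalisation: the automorphic assembly of
`HasArchParameter.map_neg_conj_of_skewHermitian` (Petersson pairing on the clean `A_G`-invariant
model of `π ⊗ |det|^{s₀}`, `ArchParameterSplitCentre`, `AutomorphicRepsGLCleanModelArch`). -/
def HermitianArchSymmetryCuspidal : Prop :=
  ∀ (n : ℕ) [NeZero n] (K : Type) [Field K] [NumberField K]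
    (hcpt : isCompact_glFiniteIntegralLevel n K)
    (π : CuspidalAutomorphicRepData n K hcpt) (χ : (K →+* ℂ) → Multiset ℂ),
    π.1.HasArchParameter χ →
      ∃ c : ℝ, ∀ σ : K →+* ℂ,
        χ (NumberField.ComplexEmbedding.conjugate σ) = (χ σ).map (fun a => -(conj a) + (c : ℂ))

/-- Card 1, the crux-level consequence ("purity of the descent parameter", replaces Clozel's
Lemme 4.9 / the unitary dual of `GL₂(ℂ)`): if the parameter of `σ₀` at `σ_w` is `{s, s + a}` with
`a ∈ ℤ`, Hermitian symmetry forces the parameter at `σ̄_w` to be `{t, t - a}` — so `b_w = -a_w` at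
EVERY complex place and `a_w + b_w` is even uniformly in `w`. -/
def DescentParameterPurity : Prop :=
  ∀ (K : Type) [Field K] [NumberField K]
    (hcpt₂ : isCompact_glFiniteIntegralLevel 2 K)
    (σ₀ : CuspidalAutomorphicRepData 2 K hcpt₂) (χ : (K →+* ℂ) → Multiset ℂ),
    σ₀.1.HasArchParameter χ →
    (∀ σ : K →+* ℂ, ∃ (s : ℂ) (a : ℤ), χ σ = {s, s + a}) →
      ∀ σ : K →+* ℂ, ∀ (s : ℂ) (a : ℤ), χ σ = {s, s + a} →
        ∃ t : ℂ, χ (NumberField.ComplexEmbedding.conjugate σ) = {t, t - a}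

/-! ## Card `sl2-multiplicity-one-transfer` -/

/-- The adjoint Satake parameter `Ad{x, y} = {x/y, y/x, 1}` in the route's inlined form. -/
def adOf (β : Multiset ℂ) : Multiset ℂ :=
  ((β ×ˢ β).map (fun p : ℂ × ℂ => p.1 * p.2⁻¹)).erase 1

/-- TRANSFER target `C⁺` (card 2): over a CM field, a regular algebraic cuspidal `π` on `GL₃` which
is an adjoint lift at Satake level (of SOME cuspidal `σ₀`, with SOME `GL(1)` datum `ν`) is the
adjoint lift of a REGULAR ALGEBRAIC cuspidal `σ` — the archimedean work is done on a CHOSEN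
representative (the descent of `π ⊗ ν⁻¹`, Ramakrishnan 2014 Thm A as printed, all places), never
on the given `σ₀`. -/
def RegularAdjointDescentArchCM : Prop :=
  ∀ (K : Type) [Field K] [NumberField K], NumberField.IsCMField K →
    ∀ (h1 : isCompact_glFiniteIntegralLevel 1 K) (hcpt₂ : isCompact_glFiniteIntegralLevel 2 K)
      (hcpt : isCompact_glFiniteIntegralLevel 3 K)
      (π : CuspidalAutomorphicRepData 3 K hcpt) (ν : CuspidalAutomorphicRepData 1 K h1),
      π.1.IsRegularAlgebraic →
      (∃ σ₀ : CuspidalAutomorphicRepData 2 K hcpt₂, ∀ᶠ v in cofinite, ∀ α β : Multiset ℂ,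
          π.1.HasSatakeParamAt v α → σ₀.1.HasSatakeParamAt v β →
            ∃ d : ℂ, ν.1.HasSatakeParamAt v {d} ∧ α = (adOf β).map (fun c => d * c)) →
      ∃ σ : CuspidalAutomorphicRepData 2 K hcpt₂, σ.1.IsRegularAlgebraic ∧
        ∀ᶠ v in cofinite, ∀ α β : Multiset ℂ,
          π.1.HasSatakeParamAt v α → σ.1.HasSatakeParamAt v β →
            ∃ d : ℂ, α = (adOf β).map (fun c => d * c)

/-- FIRST LEMMA (card 2): matching inside the twist class at FINITE places only — multiplicity one
for `SL(2)` (Ramakrishnan 2000, Thm 4.1.2 = `Ramakrishnan2000_multiplicityOneSL2`) in the crux's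
`GL(1)`-datum language: two cuspidal `GL₂` data with the same adjoint Satake parameters up to a
scalar a.e. differ by a `GL(1)` twist a.e. -/
def TwistClassMatching : Prop :=
  ∀ (K : Type) [Field K] [NumberField K]
    (h1 : isCompact_glFiniteIntegralLevel 1 K) (hcpt₂ : isCompact_glFiniteIntegralLevel 2 K)
    (σ σ₀ : CuspidalAutomorphicRepData 2 K hcpt₂),
    (∀ᶠ v in cofinite, ∀ β β' : Multiset ℂ,
        σ₀.1.HasSatakeParamAt v β → σ.1.HasSatakeParamAt v β' →
          ∃ e : ℂ, adOf β' = (adOf β).map (fun c => e * c)) →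
    ∃ χ : CuspidalAutomorphicRepData 1 K h1,
      ∀ᶠ v in cofinite, ∀ β : Multiset ℂ, σ₀.1.HasSatakeParamAt v β →
        ∃ c : ℂ, χ.1.HasSatakeParamAt v {c} ∧ σ.1.HasSatakeParamAt v (β.map (fun b => c * b))

/-- The crux `RegularTwistCM` (stmt-Langlands-14069), text copied VERBATIM from the route file rev 10 (the route
module is not imported here only to keep this scratch file independent of the farm's copy of the Theses file). -/
def RegularTwistCMText : Prop :=
  ∀ (K : Type) [Field K] [NumberField K], NumberField.IsCMField K → ∀ (h1 : Literature.NumberTheory.Automorphic.isCompact_glFiniteIntegralLevel 1 K) (hcpt₂ : Literature.NumberTheory.Automorphic.isCompact_glFiniteIntegralLevel 2 K) (hcpt : Literature.NumberTheory.Automorphic.isCompact_glFiniteIntegralLevel 3 K) (π : Literature.NumberTheory.Automorphic.CuspidalAutomorphicRepData 3 K hcpt) (σ₀ : Literature.NumberTheory.Automorphic.CuspidalAutomorphicRepData 2 K hcpt₂) (ν : Literature.NumberTheory.Automorphic.CuspidalAutomorphicRepData 1 K h1), π.1.IsRegularAlgebraic → (∀ᶠ v in cofinite, ∀ α β : Multiset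 ℂ, π.1.HasSatakeParamAt v α → σ₀.1.HasSatakeParamAt v β → ∃ d : ℂ, ν.1.HasSatakeParamAt v {d} ∧ α = (((β ×ˢ β).map (fun p : ℂ × ℂ => p.1 * p.2⁻¹)).erase 1).map (fun c => d * c)) → ∃ (σ : Literature.NumberTheory.Automorphic.CuspidalAutomorphicRepData 2 K hcpt₂) (χ : Literature.NumberTheory.Automorphic.CuspidalAutomorphicRepData 1 K h1), σ.1.IsRegularAlgebraic ∧ ∀ᶠ v in cofinite, ∀ β : Multiset ℂ, σ₀.1.HasSatakeParamAt v β → ∃ c : ℂ, χ.1.HasSatakeParamAt v {c} ∧ σ.1.HasSatakeParamAt v (β.map (fun b => c * b))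

/-- Card 2 reduction (shape only): `C⁺` and the matching lemma give the crux verbatim (proof = Satake uniqueness
`hasSatakeParamAt_unique_holds` + `hasSatakeParamAt_cofinite_holds` + μ₃-invariance of adjoint parameters +
`exists_pair_eq_map_mul_of_adjoint_eq`; left as `sorry` in this ideation sketch). -/
theorem regularTwistCM_of_transfer
    (hC : RegularAdjointDescentArchCM) (hM : TwistClassMatching) : RegularTwistCMText := by
  sorry

/-! ## Card `gamma-divisor-rigidity` -/

/-- FIRST LEMMA (card 3, analytic core): a Gamma identity pins an unordered pair — if
`Γ(s + M) Γ(s + M') = Γ(s + N)²` for all `s`, then `{M, M'} = {N, N}` (divisor comparison + one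
growth comparison; Mathlib `Complex.Gamma`, `Complex.Gamma_eq_zero_iff`). -/
def GammaPairIdentityRigid : Prop :=
  ∀ M M' N : ℂ,
    (∀ s : ℂ, Complex.Gamma (s + M) * Complex.Gamma (s + M') = Complex.Gamma (s + N) ^ 2) →
      ({M, M'} : Multiset ℂ) = {N, N}

/-- Card 3, the arithmetic tail: matching the pole divisor of the archimedean Rankin–Selberg
factor `Γ_ℂ(s)² Γ_ℂ(s + max(a,b)) Γ_ℂ(s + max(-a,-b))` of `σ₀,w × σ₀,w^∨`
(`max(a,b) := (a+b)/2 + |a-b|/2`, `a - b ∈ ℤ`) with `Γ_ℂ(s)² Γ_ℂ(s + |n|)²` coming from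
`ζ_{K,w}(s) L(s, π_w ⊗ ν_w⁻¹)` forces `b = -a` and `a = ±n`: integrality AND purity at once. -/
def PoleMatchingDeterminesPair : Prop :=
  ∀ (a b : ℂ) (k n : ℤ), a - b = k → n ≠ 0 →
    ({(a + b) / 2 + ((|k| : ℤ) : ℂ) / 2, -(a + b) / 2 + ((|k| : ℤ) : ℂ) / 2} : Multiset ℂ) =
        {((|n| : ℤ) : ℂ), ((|n| : ℤ) : ℂ)} →
      b = -a ∧ (a = n ∨ a = -n)

end Summit.Langlands.Langlands.Cruxes.RegularTwistCM.IdeasK1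

end
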